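import Literature.MathematicalPhysics.QuantumFieldTheory.Balaban1983to89.B9Eq3130NeumannLetter

/-!
# `Balaban1983to89.B9Eq3130TransferPairLetters` — T. Bałaban, *Propagators for lattice gauge theories in a background field*, Commun. Math. Phys. **99** (1985)
# 389–434 [Balaban1985BackgroundPropagators] (3.130) p. 421 (*«G = G₀(I − Δ′_πG₀)⁻¹»*), (3.119)–(3.120) p. 419 (`Δ_π = πᵗΔπ`, `π = 1 − DG′RD*`, the defect `Δ′_π`),
# (3.117) p. 419 (the Hessian on a pure gauge mode is the `J`-commutator), p. 421 l. −5 ff. (*«One of the three derivatives there has to be applied either to an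
# expression on the right, or on the left, of Δ′_π»*), (3.152) p. 426 (`G₁DR = DG′R`), Thm 3.1 (3.42) p. 397, with [Balaban1984PropagatorsII] Lemma 2.1 (2.61) p. 234:
# **THE `G₀ ↦ G̃` TRANSFER OF THE LOCAL SUP LETTERS AS A 2×2 BOOTSTRAP ON THE PAIR (VALUE ROW OF `G̃`, DIVERGENCE ROW `D*G̃`) — ONE-SIDED, NO KERNEL BOUNDS, NO THIRD
# ROW** — the NE9 owner's PLAN v14 (A-3 = R-ne9p1-g96-6, journal `HOME/CLAIMS.log` l.65765) in this lineage's (K71) frame `B9Eq3130NeumannLetter.letter_bootstrap_pair`,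
# ABSTRACT over two weighted carriers (bonds `B`, sites `S`) on a block lattice `(Y, δ)`; consult C-leaf05-g88-1 (journal l.65943) says how the two small letters
# `(L)(M)`, `(L)(M†)` (`M = Δ∘D_U`, the Hessian-on-gauge-modes stencil) are inhabited — by (3.117) under print's third window (3.36)

statement-level skeleton of published theorems with citation tags; proofs where landed; nothing here is a claim about the Yang–Mills mass gap

CITATION HEADER (lean-in-tree rule).  Audit cell `pub-balaban`, sub-cell `t4`, BINDER row NE9; filed by NE9 crux-team LEAF PROVER 05
(`b2b-balaban-t4-ne9-formalise-leaf-05`, gen 88).  Composed BY NAME from (K61) `B9Eq326G1SupRowOfLetters.letter_comp` ∕ `letter_mono` and (K71)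
`B9Eq3130NeumannLetter.letter_bootstrap_pair`; [folklore] real bookkeeping.  Source READ first-hand this generation (`paper:balaban1985-cmp99-background-propagators`,
journal page = PDF page + 388): p. 392 (3.10)–(3.12), p. 396 (3.35)–(3.36), pp. 397–399 Thm 3.1 ∕ 3.3, pp. 418–422 (3.113)–(3.133).  Print sums the Neumann series (3.130)
with the two-sided sandwich bound (3.131) in the closed system of norms (3.42)–(3.47); here the same passage is a bootstrap on TWO one-sided rows, the left gauge
mode being exchanged by the `G₀`-version of (3.152) (hypothesis `h2`).  NOTHING of print's estimates is reproduced and no constant of print is valued.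

THE ALGEBRA BEHIND THE HYPOTHESES (located, [folklore]; the instantiation at the tower is the instantiator's).  `G̃⁻¹ − G₀⁻¹ = π†Δπ − Δ =: Δ′_π`
(`B9Eq3119DeltaPiTower.laplaceAkPi` vs `B9Eq326OperatorTower.laplaceAk`, affine in the `Δ₁`-slot), `π = 1 − D∘P`, `P = G′RD*`, `P† = DRG′` (`D† = D*`, `R† = R`,
`G′† = G′`), hence **`Δ′_π = −M∘P − D∘R∘G′∘M†∘π`**, `M := Δ∘D` (sites → bonds), `M† := D*∘Δ` (bonds → sites) — print's remark that one derivative of the third term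
goes left and one goes right.  `hT` = the resolvent identity `G̃ = G₀ − G₀Δ′_πG̃`, expanded.  `h2` = the LEFT gauge mode exchanged, **`G₀(D(Rs)) = D(G′(Rs)) −
G₀(M(G′(Rs)))`** (`Δ_a(Dν) = Δ(Dν) + DRD*Dν + Q†aQDν`, `ν = G′Rs ∈ N(Q′)`, (3.115) `Q(Dν) = 0`, `D*Dν = Rs`; print's (3.152) `G₁DR = DG′R` is the `M = 0` case
for `G̃`).  `h3` = **`D*(D(G′(Rs))) = Rs`**.  Every correction term carries ONE factor `M` or `M†`, read through `(L)(M; ε₁, κ)`, `(L)(M†; ε₂, κ)`; by (3.117)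
polarized (`B9Eq3117Polarized.two_mul_bondPair_deltaOp_covDη`: `(ΔD_Uλ)(b) = (i∕2)[J(b), λ(b₋) + R_bλ(b₊)]`, zero-order in `λ`) these are `O(sup‖J‖)`, small
under print's (3.36) — that inhabitation is NOT in this file.

WHAT IS PROVED (sorry-free; proof lane — no `def`; [folklore]).  Continuous linear `G₀ G̃ : B → B`, `D M : S → B`, `D* M† : B → S`, `G′ R : S → S` on
`B = WL2 𝕜 w_B V_B` over `(X_B, π_B)`, `S = WL2 𝕜 w_S V_S` over `(X_S, π_S)`; the letter (L)(T; B, κ) DISPLAYED and read through `WL2.equiv` ((K61) ∕ (K71) shape).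
* §0 **`exists_apriori_letter₂`** — (K71) `exists_apriori_letter` between TWO carriers; `norm_six_le`; §0b **`resolvent_identity_of_slot`** — `hT` below from
  `G₀L₀ = 1`, `L̃G̃ = 1` and `L̃ = L₀ + (πᵗHπ − H)` (pure module algebra, for the instantiator: `laplaceAkPi − laplaceAk = π†Δπ − Δ`).
* §1 **`transfer_pair_step`** — `hT`, `h2`, `h3`, the letters (L)(G₀; B₀, κ), (L)(D*∘G₀; B₁, κ), (L)(G′; B_G, κ), (L)(R; B_R, κ), (L)(D∘G′∘R; B_D, κ), (L)(M; ε₁, κ),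
  (L)(M†; ε₂, κ), `0 ≤ κ′ < κ`, `Σ_u e^{−(κ−κ′)δ(w,u)} ≤ K`, a-priori (L)(G̃; M′, κ′), (L)(D*∘G̃; M′, κ′) ⟹ (L)(G̃; B₀ + q₁M′, κ′) ∧ (L)(D*∘G̃; B₁ + q₂M′, κ′), `q₁`,
  `q₂` closed-form with EVERY summand carrying `ε₁` or `ε₂` (inner factor at the target rate `κ′`, coefficient letters post-composed at rate `κ` by `letter_comp` —
  no further rate loss; `G₀`, `D*G₀` alone weakened by `letter_mono`).
* §2 **`transfer_pair`** — `q₁ < 1`, `q₂ < 1` (closed forms, named by `hq₁def`∕`hq₂def`) ⟹ **(L)(G̃; max(B₀,B₁)∕(1−max(q₁,q₂)), κ′) ∧ (L)(D*∘G̃; same, κ′)**,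
  EXPLICIT constant, NO a-priori hypothesis (over the coarse torus `T_m`: `δ = d_m`, `K = K_d(κ−κ′)` by `B4Sect5Torus.torusSum_le`, as in (K71)
  `letter_of_neumann_torus` — one line for the instantiator).
USE (the instantiator's, not here): `G₀ := G1k`, `G̃ := (laplaceAkPi)⁻¹`, `D := D_U`, `D* := D*_U`, `G′ := GpOfUk`, `R := RofUk`, `M := hessOp∘D_U`, `M† := D*_U∘hessOp`;
letters (K64) `exists_local_letter_G1k`, (DGK) `exists_divergence_row_G1k`, (DRC), the `R_k` letters, (K70) `exists_local_gradLetter_GpRk`, and the two stencil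
letters under the window `‖J_U(b)‖ ≤ α` ((3.36); consult C-leaf05-g88-1).  HONEST SCOPE.  Pure letter algebra over DISPLAYED identities and letters; constants
crude; NOT CLAIMED: that the cell adopts the (3.36) window (the owner's call); rows beyond the pair (`∇_UG̃` follows by one post-composition, (K71)
`letter_postcomp_resolvent`'s pattern).  Nothing of [B9] (3.130)–(3.133), Thm 3.1 ∕ 3.3 ∕ 3.13 is asserted, valued or discharged; «NE9 ⇐ the named binders»; NE9 NOT
PRINTED ∕ NOT PROVED; row WALLED ON A MODEL (O-NE9-1; #5 UNRULED); spine PROVED 0∕9; rung (B)+1 on a finite T⁴ — NOT infinite volume, NOT mass gap, NOT BetaPertH,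
NOT Clay.  HONEST DEPENDENCY: continuum YM on T⁴ ⇐ BetaPertH ∧ nine spine estimates (0/9 proved); BetaPertH ⇐ (D1) ∧ (D4) ∧ CAP+tail; G-an2-4 gates asym, D1
and NE2/3/4.  NEW file importing (K71) only (BUILT); nothing modified.  Net new unproved facts: 0.
-/

noncomputable section

set_option autoImplicit false

open scoped BigOperators
open Filter Topology

namespace Literature.MathematicalPhysics.QuantumFieldTheory.Balaban1983to89.B9Eq3130TransferPairLetters

open B9Eq311L2Pairing (WL2)
open B9Eq326G1SupRowOfLetters (letter_comp letter_mono)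
open B9Eq3130NeumannLetter (letter_bootstrap_pair)

/-! ## §0 Bookkeeping: an a-priori letter between two carriers; the six-term triangle inequality -/

section Apriori

variable {𝕜 : Type*} [RCLike 𝕜] {Y : Type*} [Fintype Y] (δ : Y → Y → ℝ)
  {X₁ : Type*} [Fintype X₁] [Nonempty X₁] {w₁ : X₁ → ℝ} [Fact (∀ x, 0 < w₁ x)]
  {V₁ : Type*} [NormedAddCommGroup V₁] [InnerProductSpace 𝕜 V₁]
  {X₂ : Type*} [Fintype X₂] {w₂ : X₂ → ℝ} [Fact (∀ x, 0 < w₂ x)]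
  {V₂ : Type*} [NormedAddCommGroup V₂] [InnerProductSpace 𝕜 V₂]
  (π₂ : X₂ → Y) (T : WL2 𝕜 w₁ V₁ →L[𝕜] WL2 𝕜 w₂ V₂)

/-- **AN A-PRIORI LETTER ALWAYS EXISTS ON FINITE CARRIERS** (two-carrier form of (K71) `exists_apriori_letter`): for every continuous linear `T : WL2 w₁ V₁ → WL2 w₂ V₂`
and `κ′ ≥ 0` there is `M ≥ 0` with `‖(Tf)(x)‖ ≤ M·e^{−κ′δ(π₂x, v)}·F` whenever `‖f‖_∞ ≤ F` — operator norm × √(total input mass) ∕ √(output weight floor) ×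
`e^{κ′·max δ}`.  It feeds `transfer_pair`, whose conclusion does not see `M`. [folklore] [cite: Balaban1985BackgroundPropagators, (3.130) p.421, (3.11) p.392] -/
theorem exists_apriori_letter₂ {κ' : ℝ} (hκ' : 0 ≤ κ') :
    ∃ M : ℝ, 0 ≤ M ∧ ∀ (v : Y) (f : WL2 𝕜 w₁ V₁) (F : ℝ), (∀ x, ‖WL2.equiv 𝕜 w₁ V₁ f x‖ ≤ F) →
      ∀ x, ‖WL2.equiv 𝕜 w₂ V₂ (T f) x‖ ≤ M * Real.exp (-(κ' * δ (π₂ x) v)) * F := by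
  classical
  obtain ⟨x₀⟩ := ‹Nonempty X₁›
  have hw₁ : ∀ x, 0 < w₁ x := Fact.out
  have hw₂ : ∀ x, 0 < w₂ x := Fact.out
  by_cases hY : Nonempty Y
  swap
  · exact ⟨0, le_rfl, fun v _ _ _ _ => (hY ⟨v⟩).elim⟩
  by_cases hX₂ : Nonempty X₂
  swap
  · exact ⟨0, le_rfl, fun _ _ _ _ x => (hX₂ ⟨x⟩).elim⟩
  -- the largest distance, the smallest output weight, the total input mass
  obtain ⟨p₀, hp₀⟩ := Finite.exists_max (fun p : Y × Y => δ p.1 p.2)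
  obtain ⟨x₁, hx₁⟩ := Finite.exists_min w₂
  set Dm : ℝ := δ p₀.1 p₀.2 with hDm
  set ω : ℝ := w₂ x₁ with hω
  have hω0 : 0 < ω := hw₂ x₁
  set Wt : ℝ := ∑ x, w₁ x with hWt
  have hWt0 : 0 ≤ Wt := Finset.sum_nonneg fun x _ => (hw₁ x).le
  refine ⟨‖T‖ * Real.sqrt Wt / Real.sqrt ω * Real.exp (κ' * Dm), by positivity, ?_⟩
  intro v f F hfF x
  have hF : 0 ≤ F := (norm_nonneg _).trans (hfF x₀)
  -- `‖f‖ ≤ √Wt·F`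
  have hf2 : ‖f‖ ^ 2 ≤ (Real.sqrt Wt * F) ^ 2 := by
    rw [WL2.norm_sq (𝕜 := 𝕜) (w := w₁) (V := V₁), mul_pow, Real.sq_sqrt hWt0, hWt, Finset.sum_mul]
    exact Finset.sum_le_sum fun y _ => mul_le_mul_of_nonneg_left (pow_le_pow_left₀ (norm_nonneg _) (hfF y) 2) (hw₁ y).le
  have hf : ‖f‖ ≤ Real.sqrt Wt * F := (pow_le_pow_iff_left₀ (norm_nonneg _) (by positivity) two_ne_zero).1 hf2
  -- `√ω·‖(Tf)(x)‖ ≤ ‖Tf‖ ≤ ‖T‖·‖f‖`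
  have h1 := WL2.weight_mul_norm_sq_apply_le (𝕜 := 𝕜) (w := w₂) (T f) x
  have h2 : w₂ x * ‖WL2.equiv 𝕜 w₂ V₂ (T f) x‖ ^ 2 ≤ (‖T‖ * (Real.sqrt Wt * F)) ^ 2 :=
    h1.trans (pow_le_pow_left₀ (norm_nonneg _) ((T.le_opNorm f).trans (mul_le_mul_of_nonneg_left hf (norm_nonneg _))) 2)
  have h3 : ω * ‖WL2.equiv 𝕜 w₂ V₂ (T f) x‖ ^ 2 ≤ (‖T‖ * (Real.sqrt Wt * F)) ^ 2 :=
    (mul_le_mul_of_nonneg_right (hx₁ x) (sq_nonneg _)).trans h2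
  have h4 : (Real.sqrt ω * ‖WL2.equiv 𝕜 w₂ V₂ (T f) x‖) ^ 2 ≤ (‖T‖ * (Real.sqrt Wt * F)) ^ 2 := by
    rw [mul_pow, Real.sq_sqrt hω0.le]; exact h3
  have h5 : Real.sqrt ω * ‖WL2.equiv 𝕜 w₂ V₂ (T f) x‖ ≤ ‖T‖ * (Real.sqrt Wt * F) :=
    (pow_le_pow_iff_left₀ (by positivity) (by positivity) two_ne_zero).1 h4
  have hsω : 0 < Real.sqrt ω := Real.sqrt_pos.2 hω0
  have h6 : ‖WL2.equiv 𝕜 w₂ V₂ (T f) x‖ ≤ ‖T‖ * Real.sqrt Wt / Real.sqrt ω * F := by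
    have h := (le_div_iff₀ hsω).2 ((mul_comm _ _).trans_le h5)
    calc ‖WL2.equiv 𝕜 w₂ V₂ (T f) x‖ ≤ ‖T‖ * (Real.sqrt Wt * F) / Real.sqrt ω := h
      _ = ‖T‖ * Real.sqrt Wt / Real.sqrt ω * F := by ring
  -- the exponential is at least `e^{−κ′·Dm}`
  have hδle : δ (π₂ x) v ≤ Dm := hp₀ (π₂ x, v)
  have hexp : Real.exp (-(κ' * Dm)) ≤ Real.exp (-(κ' * δ (π₂ x) v)) :=
    Real.exp_le_exp.2 (neg_le_neg (mul_le_mul_of_nonneg_left hδle hκ'))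
  calc ‖WL2.equiv 𝕜 w₂ V₂ (T f) x‖ ≤ ‖T‖ * Real.sqrt Wt / Real.sqrt ω * F := h6
    _ = ‖T‖ * Real.sqrt Wt / Real.sqrt ω * Real.exp (κ' * Dm) * Real.exp (-(κ' * Dm)) * F := by
        rw [mul_assoc (‖T‖ * Real.sqrt Wt / Real.sqrt ω), ← Real.exp_add, add_neg_cancel, Real.exp_zero, mul_one]
    _ ≤ ‖T‖ * Real.sqrt Wt / Real.sqrt ω * Real.exp (κ' * Dm) * Real.exp (-(κ' * δ (π₂ x) v)) * F :=
        mul_le_mul_of_nonneg_right (mul_le_mul_of_nonneg_left hexp (by positivity)) hF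

end Apriori

/-- The triangle inequality for the six terms of the expanded resolvent identity. [folklore] -/
private theorem norm_six_le {V : Type*} [NormedAddCommGroup V] (a b c d e g : V) :
    ‖a + b + (c - d) - (e - g)‖ ≤ ‖a‖ + ‖b‖ + ‖c‖ + ‖d‖ + ‖e‖ + ‖g‖ := by
  calc ‖a + b + (c - d) - (e - g)‖ ≤ ‖a + b + (c - d)‖ + ‖e - g‖ := norm_sub_le _ _
    _ ≤ (‖a + b‖ + ‖c - d‖) + (‖e‖ + ‖g‖) := add_le_add (norm_add_le _ _) (norm_sub_le _ _)
    _ ≤ ((‖a‖ + ‖b‖) + (‖c‖ + ‖d‖)) + (‖e‖ + ‖g‖) := add_le_add (add_le_add (norm_add_le _ _) (norm_sub_le _ _)) le_rfl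
    _ = _ := by ring

/-! ## §0b The hypothesis `hT` from the slot perturbation (pure algebra, for the instantiator) -/

section Resolvent

variable {R₀ : Type*} [Ring R₀] {B S : Type*} [AddCommGroup B] [Module R₀ B] [AddCommGroup S] [Module R₀ S]

/-- **`hT` FROM THE SLOT PERTURBATION**: if `G₀` is a left inverse of `L₀`, `G̃` a right inverse of `L̃`, and `L̃ = L₀ + (πᵗ∘H∘π − H)` with `π = 1 − D∘P`,
`πᵗ = 1 − Pᵗ∘D*`, `P = G′∘R∘D*`, `Pᵗ = D∘R∘G′` (print's `G̃⁻¹ − G₀⁻¹ = Δ′_π = π†Δπ − Δ`), then the resolvent identity holds in the expanded form `hT` of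
`transfer_pair` with `M := H∘D`, `M† := D*∘H`. [folklore] [cite: Balaban1985BackgroundPropagators, (3.130) p.421, (3.119)–(3.120) p.419, (3.122) p.420] -/
theorem resolvent_identity_of_slot (G₀ Gt L₀ Lt H : B →ₗ[R₀] B) (D : S →ₗ[R₀] B) (Ds : B →ₗ[R₀] S) (Gp R : S →ₗ[R₀] S)
    (hG₀ : ∀ g, G₀ (L₀ g) = g) (hGt : ∀ f, Lt (Gt f) = f)
    (hslot : ∀ g, Lt g = L₀ g + ((H (g - D (Gp (R (Ds g)))) - D (R (Gp (Ds (H (g - D (Gp (R (Ds g))))))))) - H g)) (f : B) :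
    Gt f = G₀ f + G₀ (H (D (Gp (R (Ds (Gt f)))))) + G₀ (D (R (Gp (Ds (H (Gt f - D (Gp (R (Ds (Gt f)))))))))) := by
  have h2 : L₀ (Gt f) = f - ((H (Gt f - D (Gp (R (Ds (Gt f))))) - D (R (Gp (Ds (H (Gt f - D (Gp (R (Ds (Gt f)))))))))) - H (Gt f)) := by
    have h := hslot (Gt f)
    rw [hGt] at h
    rw [eq_sub_iff_add_eq]
    exact h.symm
  conv_lhs => rw [← hG₀ (Gt f), h2]
  simp only [map_sub]
  abel

end Resolvent

/-! ## §1 The one-step improvement of the pair (value row of `G̃`, divergence row `D*G̃`) on an abstract block lattice -/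

section Abstract

variable {𝕜 : Type*} [RCLike 𝕜] {Y : Type*} [Fintype Y] (δ : Y → Y → ℝ)
  {XB : Type*} [Fintype XB] [Nonempty XB] {wB : XB → ℝ} [Fact (∀ x, 0 < wB x)]
  {VB : Type*} [NormedAddCommGroup VB] [InnerProductSpace 𝕜 VB]
  {XS : Type*} [Fintype XS] {wS : XS → ℝ} [Fact (∀ x, 0 < wS x)]
  {VS : Type*} [NormedAddCommGroup VS] [InnerProductSpace 𝕜 VS]
  (πB : XB → Y) (πS : XS → Y)
  (G₀ Gt : WL2 𝕜 wB VB →L[𝕜] WL2 𝕜 wB VB) (D M : WL2 𝕜 wS VS →L[𝕜] WL2 𝕜 wB VB)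
  (Ds Mt : WL2 𝕜 wB VB →L[𝕜] WL2 𝕜 wS VS) (Gp R : WL2 𝕜 wS VS →L[𝕜] WL2 𝕜 wS VS)

set_option maxHeartbeats 400000 in
/-- **THE ONE-STEP IMPROVEMENT OF THE PAIR** ((3.130) with `Δ′_π = −M∘P − D∘R∘G′∘M†∘π` expanded — hypothesis `hT` —, the left gauge mode exchanged by `h2`, the
divergence of the exchanged mode by `h3`): a-priori letters (L)(G̃; M′, κ′), (L)(D*∘G̃; M′, κ′) and the eight coefficient letters at the primitive rate `κ` give
(L)(G̃; B₀ + q₁M′, κ′) ∧ (L)(D*∘G̃; B₁ + q₂M′, κ′), every summand of `q₁`, `q₂` carrying the stencil constant `ε₁` or `ε₂`. [folklore]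
[cite: Balaban1985BackgroundPropagators, (3.130) p.421, (3.120) p.419, (3.117) p.419, (3.152) p.426, Thm 3.1 (3.42) p.397] [cite: Balaban1984PropagatorsII, Lemma 2.1 (2.61) p.234] -/
theorem transfer_pair_step (hδ0 : ∀ u v, 0 ≤ δ u v) (hδt : ∀ u y v, δ u v ≤ δ u y + δ y v)
    (hT : ∀ f, Gt f = G₀ f + G₀ (M (Gp (R (Ds (Gt f))))) + G₀ (D (R (Gp (Mt (Gt f - D (Gp (R (Ds (Gt f))))))))))
    (h2 : ∀ s, G₀ (D (R s)) = D (Gp (R s)) - G₀ (M (Gp (R s))))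
    (h3 : ∀ s, Ds (D (Gp (R s))) = R s)
    {B₀ B₁ BG BR BD ε₁ ε₂ κ κ' K M' : ℝ} (hB₀ : 0 ≤ B₀) (hB₁ : 0 ≤ B₁) (hBG : 0 ≤ BG) (hBR : 0 ≤ BR) (hBD : 0 ≤ BD)
    (hε₁ : 0 ≤ ε₁) (hε₂ : 0 ≤ ε₂) (hκ' : 0 ≤ κ') (hκ : κ' < κ) (hM' : 0 ≤ M')
    (hG0 : ∀ (v : Y) (f : WL2 𝕜 wB VB) (F : ℝ), (∀ x, πB x ≠ v → WL2.equiv 𝕜 wB VB f x = 0) → (∀ x, ‖WL2.equiv 𝕜 wB VB f x‖ ≤ F) →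
      ∀ x, ‖WL2.equiv 𝕜 wB VB (G₀ f) x‖ ≤ B₀ * Real.exp (-(κ * δ (πB x) v)) * F)
    (hDsG0 : ∀ (v : Y) (f : WL2 𝕜 wB VB) (F : ℝ), (∀ x, πB x ≠ v → WL2.equiv 𝕜 wB VB f x = 0) → (∀ x, ‖WL2.equiv 𝕜 wB VB f x‖ ≤ F) →
      ∀ x, ‖WL2.equiv 𝕜 wS VS (Ds (G₀ f)) x‖ ≤ B₁ * Real.exp (-(κ * δ (πS x) v)) * F)
    (hGp : ∀ (v : Y) (s : WL2 𝕜 wS VS) (F : ℝ), (∀ x, πS x ≠ v → WL2.equiv 𝕜 wS VS s x = 0) → (∀ x, ‖WL2.equiv 𝕜 wS VS s x‖ ≤ F) →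
      ∀ x, ‖WL2.equiv 𝕜 wS VS (Gp s) x‖ ≤ BG * Real.exp (-(κ * δ (πS x) v)) * F)
    (hR : ∀ (v : Y) (s : WL2 𝕜 wS VS) (F : ℝ), (∀ x, πS x ≠ v → WL2.equiv 𝕜 wS VS s x = 0) → (∀ x, ‖WL2.equiv 𝕜 wS VS s x‖ ≤ F) →
      ∀ x, ‖WL2.equiv 𝕜 wS VS (R s) x‖ ≤ BR * Real.exp (-(κ * δ (πS x) v)) * F)
    (hDGR : ∀ (v : Y) (s : WL2 𝕜 wS VS) (F : ℝ), (∀ x, πS x ≠ v → WL2.equiv 𝕜 wS VS s x = 0) → (∀ x, ‖WL2.equiv 𝕜 wS VS s x‖ ≤ F) →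
      ∀ x, ‖WL2.equiv 𝕜 wB VB (D (Gp (R s))) x‖ ≤ BD * Real.exp (-(κ * δ (πB x) v)) * F)
    (hM : ∀ (v : Y) (s : WL2 𝕜 wS VS) (F : ℝ), (∀ x, πS x ≠ v → WL2.equiv 𝕜 wS VS s x = 0) → (∀ x, ‖WL2.equiv 𝕜 wS VS s x‖ ≤ F) →
      ∀ x, ‖WL2.equiv 𝕜 wB VB (M s) x‖ ≤ ε₁ * Real.exp (-(κ * δ (πB x) v)) * F)
    (hMt : ∀ (v : Y) (f : WL2 𝕜 wB VB) (F : ℝ), (∀ x, πB x ≠ v → WL2.equiv 𝕜 wB VB f x = 0) → (∀ x, ‖WL2.equiv 𝕜 wB VB f x‖ ≤ F) →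
      ∀ x, ‖WL2.equiv 𝕜 wS VS (Mt f) x‖ ≤ ε₂ * Real.exp (-(κ * δ (πS x) v)) * F)
    (hS : ∀ w', ∑ u, Real.exp (-((κ - κ') * δ w' u)) ≤ K)
    (hT1 : ∀ (v : Y) (f : WL2 𝕜 wB VB) (F : ℝ), (∀ x, πB x ≠ v → WL2.equiv 𝕜 wB VB f x = 0) → (∀ x, ‖WL2.equiv 𝕜 wB VB f x‖ ≤ F) →
      ∀ x, ‖WL2.equiv 𝕜 wB VB (Gt f) x‖ ≤ M' * Real.exp (-(κ' * δ (πB x) v)) * F)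
    (hT2 : ∀ (v : Y) (f : WL2 𝕜 wB VB) (F : ℝ), (∀ x, πB x ≠ v → WL2.equiv 𝕜 wB VB f x = 0) → (∀ x, ‖WL2.equiv 𝕜 wB VB f x‖ ≤ F) →
      ∀ x, ‖WL2.equiv 𝕜 wS VS (Ds (Gt f)) x‖ ≤ M' * Real.exp (-(κ' * δ (πS x) v)) * F) :
    (∀ (v : Y) (f : WL2 𝕜 wB VB) (F : ℝ), (∀ x, πB x ≠ v → WL2.equiv 𝕜 wB VB f x = 0) → (∀ x, ‖WL2.equiv 𝕜 wB VB f x‖ ≤ F) →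
      ∀ x, ‖WL2.equiv 𝕜 wB VB (Gt f) x‖ ≤
        (B₀ + (BR * K * BG * K * ε₁ * K * B₀ * K + ε₂ * K * BG * K * BD * K + BD * K * ε₂ * K * BG * K * BD * K +
          ε₂ * K * BG * K * BR * K * BG * K * ε₁ * K * B₀ * K + BD * K * ε₂ * K * BG * K * BR * K * BG * K * ε₁ * K * B₀ * K) * M') *
        Real.exp (-(κ' * δ (πB x) v)) * F) ∧
    (∀ (v : Y) (f : WL2 𝕜 wB VB) (F : ℝ), (∀ x, πB x ≠ v → WL2.equiv 𝕜 wB VB f x = 0) → (∀ x, ‖WL2.equiv 𝕜 wB VB f x‖ ≤ F) →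
      ∀ x, ‖WL2.equiv 𝕜 wS VS (Ds (Gt f)) x‖ ≤
        (B₁ + (BR * K * BG * K * ε₁ * K * B₁ * K + ε₂ * K * BG * K * BR * K + BD * K * ε₂ * K * BG * K * BR * K +
          ε₂ * K * BG * K * BR * K * BG * K * ε₁ * K * B₁ * K + BD * K * ε₂ * K * BG * K * BR * K * BG * K * ε₁ * K * B₁ * K) * M') *
        Real.exp (-(κ' * δ (πS x) v)) * F) := by
  have hK : 0 ≤ K := by
    obtain ⟨x₀⟩ := ‹Nonempty XB›
    exact (Finset.sum_nonneg fun u _ => Real.exp_nonneg _).trans (hS (πB x₀))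
  -- the a-priori letters and the coefficient letters as letters of continuous linear COMPOSITES (all `rfl`)
  have hT2' : ∀ (v : Y) (f : WL2 𝕜 wB VB) (F : ℝ), (∀ x, πB x ≠ v → WL2.equiv 𝕜 wB VB f x = 0) → (∀ x, ‖WL2.equiv 𝕜 wB VB f x‖ ≤ F) →
      ∀ x, ‖WL2.equiv 𝕜 wS VS ((Ds ∘L Gt) f) x‖ ≤ M' * Real.exp (-(κ' * δ (πS x) v)) * F := hT2
  have hDsG0' : ∀ (v : Y) (f : WL2 𝕜 wB VB) (F : ℝ), (∀ x, πB x ≠ v → WL2.equiv 𝕜 wB VB f x = 0) → (∀ x, ‖WL2.equiv 𝕜 wB VB f x‖ ≤ F) →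
      ∀ x, ‖WL2.equiv 𝕜 wS VS ((Ds ∘L G₀) f) x‖ ≤ B₁ * Real.exp (-(κ * δ (πS x) v)) * F := hDsG0
  have hDGR' : ∀ (v : Y) (s : WL2 𝕜 wS VS) (F : ℝ), (∀ x, πS x ≠ v → WL2.equiv 𝕜 wS VS s x = 0) → (∀ x, ‖WL2.equiv 𝕜 wS VS s x‖ ≤ F) →
      ∀ x, ‖WL2.equiv 𝕜 wB VB ((D ∘L Gp ∘L R) s) x‖ ≤ BD * Real.exp (-(κ * δ (πB x) v)) * F := hDGR
  -- CHAIN c (from the divergence row `T₂ = D*∘G̃`): `R`, `G′`, `M`, then `G₀` resp. `D*G₀`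
  have c1 := letter_comp δ πB πS πS (Ds ∘L Gt) R hδ0 hδt hM' hBR hκ' le_rfl hT2' hR hS
  have c2 := letter_comp δ πB πS πS (R ∘L (Ds ∘L Gt)) Gp hδ0 hδt (by positivity) hBG hκ' le_rfl c1 hGp hS
  have c3 := letter_comp δ πB πS πB (Gp ∘L (R ∘L (Ds ∘L Gt))) M hδ0 hδt (by positivity) hε₁ hκ' le_rfl c2 hM hS
  have t1 := letter_comp δ πB πB πB (M ∘L (Gp ∘L (R ∘L (Ds ∘L Gt)))) G₀ hδ0 hδt (by positivity) hB₀ hκ' le_rfl c3 hG0 hS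
  have u1 := letter_comp δ πB πB πS (M ∘L (Gp ∘L (R ∘L (Ds ∘L Gt)))) (Ds ∘L G₀) hδ0 hδt (by positivity) hB₁ hκ' le_rfl c3 hDsG0' hS
  -- CHAIN d (from the value row `T₁ = G̃`): `M†`, `G′`, then `D∘G′∘R` ∕ `R`, `G′`, `M`, `G₀` ∕ `D*G₀`
  have d1 := letter_comp δ πB πB πS Gt Mt hδ0 hδt hM' hε₂ hκ' le_rfl hT1 hMt hS
  have d2 := letter_comp δ πB πS πS (Mt ∘L Gt) Gp hδ0 hδt (by positivity) hBG hκ' le_rfl d1 hGp hS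
  have t2a := letter_comp δ πB πS πB (Gp ∘L (Mt ∘L Gt)) (D ∘L Gp ∘L R) hδ0 hδt (by positivity) hBD hκ' le_rfl d2 hDGR' hS
  have u2a := letter_comp δ πB πS πS (Gp ∘L (Mt ∘L Gt)) R hδ0 hδt (by positivity) hBR hκ' le_rfl d2 hR hS
  have d5 := letter_comp δ πB πS πS (R ∘L (Gp ∘L (Mt ∘L Gt))) Gp hδ0 hδt (by positivity) hBG hκ' le_rfl u2a hGp hS
  have d6 := letter_comp δ πB πS πB (Gp ∘L (R ∘L (Gp ∘L (Mt ∘L Gt)))) M hδ0 hδt (by positivity) hε₁ hκ' le_rfl d5 hM hS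
  have t3a := letter_comp δ πB πB πB (M ∘L (Gp ∘L (R ∘L (Gp ∘L (Mt ∘L Gt))))) G₀ hδ0 hδt (by positivity) hB₀ hκ' le_rfl d6 hG0 hS
  have u3a := letter_comp δ πB πB πS (M ∘L (Gp ∘L (R ∘L (Gp ∘L (Mt ∘L Gt))))) (Ds ∘L G₀) hδ0 hδt (by positivity) hB₁ hκ' le_rfl d6 hDsG0' hS
  -- CHAIN e (from `T₂` through `D∘G′∘R`): `M†`, `G′`, then `D∘G′∘R` ∕ `R`, `G′`, `M`, `G₀` ∕ `D*G₀`
  have e1 := letter_comp δ πB πS πB (Ds ∘L Gt) (D ∘L Gp ∘L R) hδ0 hδt hM' hBD hκ' le_rfl hT2' hDGR' hS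
  have e2 := letter_comp δ πB πB πS ((D ∘L Gp ∘L R) ∘L (Ds ∘L Gt)) Mt hδ0 hδt (by positivity) hε₂ hκ' le_rfl e1 hMt hS
  have e3 := letter_comp δ πB πS πS (Mt ∘L ((D ∘L Gp ∘L R) ∘L (Ds ∘L Gt))) Gp hδ0 hδt (by positivity) hBG hκ' le_rfl e2 hGp hS
  have t2b := letter_comp δ πB πS πB (Gp ∘L (Mt ∘L ((D ∘L Gp ∘L R) ∘L (Ds ∘L Gt)))) (D ∘L Gp ∘L R) hδ0 hδt (by positivity) hBD hκ' le_rfl e3 hDGR' hS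
  have u2b := letter_comp δ πB πS πS (Gp ∘L (Mt ∘L ((D ∘L Gp ∘L R) ∘L (Ds ∘L Gt)))) R hδ0 hδt (by positivity) hBR hκ' le_rfl e3 hR hS
  have e6 := letter_comp δ πB πS πS (R ∘L (Gp ∘L (Mt ∘L ((D ∘L Gp ∘L R) ∘L (Ds ∘L Gt))))) Gp hδ0 hδt (by positivity) hBG hκ' le_rfl u2b hGp hS
  have e7 := letter_comp δ πB πS πB (Gp ∘L (R ∘L (Gp ∘L (Mt ∘L ((D ∘L Gp ∘L R) ∘L (Ds ∘L Gt)))))) M hδ0 hδt (by positivity) hε₁ hκ' le_rfl e6 hM hS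
  have t3b := letter_comp δ πB πB πB (M ∘L (Gp ∘L (R ∘L (Gp ∘L (Mt ∘L ((D ∘L Gp ∘L R) ∘L (Ds ∘L Gt))))))) G₀ hδ0 hδt (by positivity) hB₀ hκ' le_rfl
    e7 hG0 hS
  have u3b := letter_comp δ πB πB πS (M ∘L (Gp ∘L (R ∘L (Gp ∘L (Mt ∘L ((D ∘L Gp ∘L R) ∘L (Ds ∘L Gt))))))) (Ds ∘L G₀) hδ0 hδt (by positivity) hB₁ hκ'
    le_rfl e7 hDsG0' hS
  -- the expanded identities
  have hs : ∀ f, Gp (Mt (Gt f - D (Gp (R (Ds (Gt f)))))) = Gp (Mt (Gt f)) - Gp (Mt (D (Gp (R (Ds (Gt f)))))) := fun f => by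
    rw [map_sub, map_sub]
  have hval : ∀ f, Gt f = G₀ f + G₀ (M (Gp (R (Ds (Gt f))))) +
      (D (Gp (R (Gp (Mt (Gt f))))) - D (Gp (R (Gp (Mt (D (Gp (R (Ds (Gt f)))))))))) -
      (G₀ (M (Gp (R (Gp (Mt (Gt f)))))) - G₀ (M (Gp (R (Gp (Mt (D (Gp (R (Ds (Gt f))))))))))) := fun f => by
    have h := hT f
    rw [h2, hs] at h
    refine h.trans ?_
    simp only [map_sub]; abel
  have hdiv : ∀ f, Ds (Gt f) = Ds (G₀ f) + Ds (G₀ (M (Gp (R (Ds (Gt f)))))) +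
      (R (Gp (Mt (Gt f))) - R (Gp (Mt (D (Gp (R (Ds (Gt f)))))))) -
      (Ds (G₀ (M (Gp (R (Gp (Mt (Gt f))))))) - Ds (G₀ (M (Gp (R (Gp (Mt (D (Gp (R (Ds (Gt f)))))))))))) := fun f => by
    have h := hT f
    rw [h2, hs] at h
    refine (congrArg Ds h).trans ?_
    simp only [map_sub, map_add, h3]; abel
  refine ⟨fun v f F hfv hfF x => ?_, fun v f F hfv hfF x => ?_⟩
  · -- THE VALUE ROW
    set E : ℝ := Real.exp (-(κ' * δ (πB x) v))
    have a0 : ‖WL2.equiv 𝕜 wB VB (G₀ f) x‖ ≤ B₀ * E * F := letter_mono δ πB πB G₀ hδ0 hB₀ le_rfl hκ.le hG0 v f F hfv hfF x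
    have a1 : ‖WL2.equiv 𝕜 wB VB (G₀ (M (Gp (R (Ds (Gt f)))))) x‖ ≤ M' * BR * K * BG * K * ε₁ * K * B₀ * K * E * F := t1 v f F hfv hfF x
    have a2 : ‖WL2.equiv 𝕜 wB VB (D (Gp (R (Gp (Mt (Gt f)))))) x‖ ≤ M' * ε₂ * K * BG * K * BD * K * E * F := t2a v f F hfv hfF x
    have a3 : ‖WL2.equiv 𝕜 wB VB (D (Gp (R (Gp (Mt (D (Gp (R (Ds (Gt f)))))))))) x‖ ≤ M' * BD * K * ε₂ * K * BG * K * BD * K * E * F :=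
      t2b v f F hfv hfF x
    have a4 : ‖WL2.equiv 𝕜 wB VB (G₀ (M (Gp (R (Gp (Mt (Gt f))))))) x‖ ≤ M' * ε₂ * K * BG * K * BR * K * BG * K * ε₁ * K * B₀ * K * E * F :=
      t3a v f F hfv hfF x
    have a5 : ‖WL2.equiv 𝕜 wB VB (G₀ (M (Gp (R (Gp (Mt (D (Gp (R (Ds (Gt f))))))))))) x‖ ≤
        M' * BD * K * ε₂ * K * BG * K * BR * K * BG * K * ε₁ * K * B₀ * K * E * F := t3b v f F hfv hfF x
    rw [hval f]
    simp only [WL2.equiv_add, WL2.equiv_sub, Pi.add_apply, Pi.sub_apply]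
    refine (norm_six_le _ _ _ _ _ _).trans ?_
    have hsum := add_le_add (add_le_add (add_le_add (add_le_add (add_le_add a0 a1) a2) a3) a4) a5
    refine hsum.trans (le_of_eq ?_)
    ring
  · -- THE DIVERGENCE ROW
    set E : ℝ := Real.exp (-(κ' * δ (πS x) v))
    have a0 : ‖WL2.equiv 𝕜 wS VS (Ds (G₀ f)) x‖ ≤ B₁ * E * F := letter_mono δ πB πS (Ds ∘L G₀) hδ0 hB₁ le_rfl hκ.le hDsG0' v f F hfv hfF x
    have a1 : ‖WL2.equiv 𝕜 wS VS (Ds (G₀ (M (Gp (R (Ds (Gt f))))))) x‖ ≤ M' * BR * K * BG * K * ε₁ * K * B₁ * K * E * F := u1 v f F hfv hfF x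
    have a2 : ‖WL2.equiv 𝕜 wS VS (R (Gp (Mt (Gt f)))) x‖ ≤ M' * ε₂ * K * BG * K * BR * K * E * F := u2a v f F hfv hfF x
    have a3 : ‖WL2.equiv 𝕜 wS VS (R (Gp (Mt (D (Gp (R (Ds (Gt f)))))))) x‖ ≤ M' * BD * K * ε₂ * K * BG * K * BR * K * E * F := u2b v f F hfv hfF x
    have a4 : ‖WL2.equiv 𝕜 wS VS (Ds (G₀ (M (Gp (R (Gp (Mt (Gt f)))))))) x‖ ≤ M' * ε₂ * K * BG * K * BR * K * BG * K * ε₁ * K * B₁ * K * E * F :=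
      u3a v f F hfv hfF x
    have a5 : ‖WL2.equiv 𝕜 wS VS (Ds (G₀ (M (Gp (R (Gp (Mt (D (Gp (R (Ds (Gt f)))))))))))) x‖ ≤
        M' * BD * K * ε₂ * K * BG * K * BR * K * BG * K * ε₁ * K * B₁ * K * E * F := u3b v f F hfv hfF x
    rw [hdiv f]
    simp only [WL2.equiv_add, WL2.equiv_sub, Pi.add_apply, Pi.sub_apply]
    refine (norm_six_le _ _ _ _ _ _).trans ?_
    have hsum := add_le_add (add_le_add (add_le_add (add_le_add (add_le_add a0 a1) a2) a3) a4) a5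
    refine hsum.trans (le_of_eq ?_)
    ring

/-! ## §2 The transfer: both rows height-free, no a-priori hypothesis -/

/-- **THE `G₀ ↦ G̃` TRANSFER OF THE PAIR** ((3.130) in the one-sided (L)-currency): the identities `hT`, `h2`, `h3`, the eight coefficient letters at rate `κ`,
`0 ≤ κ′ < κ`, the row constant `K` and the two CLOSED-FORM contraction factors `q₁`, `q₂` (binders with their defining equations `hq₁def`, `hq₂def`; every
summand carries `ε₁` or `ε₂` — small when the stencil `M = Δ∘D_U` is) with `q₁ < 1`, `q₂ < 1` ⟹ **(L)(G̃; max(B₀,B₁)∕(1 − max(q₁,q₂)), κ′)** and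
**(L)(D*∘G̃; max(B₀,B₁)∕(1 − max(q₁,q₂)), κ′)** — the constant is EXPLICIT (ne9-leaf-06 g86 X322 HOLD-1: no hidden `∃ q`); the a-priori letters of §0 are used
inside and are not seen by the conclusion. [folklore] [cite: Balaban1985BackgroundPropagators, (3.130)–(3.131) pp.421–422, (3.117) p.419, (3.152) p.426, Thm 3.1 (3.42) p.397, Thm 3.3 p.399]
[cite: Balaban1984PropagatorsII, Lemma 2.1 (2.61) p.234] -/
theorem transfer_pair (hδ0 : ∀ u v, 0 ≤ δ u v) (hδt : ∀ u y v, δ u v ≤ δ u y + δ y v)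
    (hT : ∀ f, Gt f = G₀ f + G₀ (M (Gp (R (Ds (Gt f))))) + G₀ (D (R (Gp (Mt (Gt f - D (Gp (R (Ds (Gt f))))))))))
    (h2 : ∀ s, G₀ (D (R s)) = D (Gp (R s)) - G₀ (M (Gp (R s))))
    (h3 : ∀ s, Ds (D (Gp (R s))) = R s)
    {B₀ B₁ BG BR BD ε₁ ε₂ κ κ' K : ℝ} (hB₀ : 0 ≤ B₀) (hB₁ : 0 ≤ B₁) (hBG : 0 ≤ BG) (hBR : 0 ≤ BR) (hBD : 0 ≤ BD)
    (hε₁ : 0 ≤ ε₁) (hε₂ : 0 ≤ ε₂) (hκ' : 0 ≤ κ') (hκ : κ' < κ)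
    (hG0 : ∀ (v : Y) (f : WL2 𝕜 wB VB) (F : ℝ), (∀ x, πB x ≠ v → WL2.equiv 𝕜 wB VB f x = 0) → (∀ x, ‖WL2.equiv 𝕜 wB VB f x‖ ≤ F) →
      ∀ x, ‖WL2.equiv 𝕜 wB VB (G₀ f) x‖ ≤ B₀ * Real.exp (-(κ * δ (πB x) v)) * F)
    (hDsG0 : ∀ (v : Y) (f : WL2 𝕜 wB VB) (F : ℝ), (∀ x, πB x ≠ v → WL2.equiv 𝕜 wB VB f x = 0) → (∀ x, ‖WL2.equiv 𝕜 wB VB f x‖ ≤ F) →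
      ∀ x, ‖WL2.equiv 𝕜 wS VS (Ds (G₀ f)) x‖ ≤ B₁ * Real.exp (-(κ * δ (πS x) v)) * F)
    (hGp : ∀ (v : Y) (s : WL2 𝕜 wS VS) (F : ℝ), (∀ x, πS x ≠ v → WL2.equiv 𝕜 wS VS s x = 0) → (∀ x, ‖WL2.equiv 𝕜 wS VS s x‖ ≤ F) →
      ∀ x, ‖WL2.equiv 𝕜 wS VS (Gp s) x‖ ≤ BG * Real.exp (-(κ * δ (πS x) v)) * F)
    (hR : ∀ (v : Y) (s : WL2 𝕜 wS VS) (F : ℝ), (∀ x, πS x ≠ v → WL2.equiv 𝕜 wS VS s x = 0) → (∀ x, ‖WL2.equiv 𝕜 wS VS s x‖ ≤ F) →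
      ∀ x, ‖WL2.equiv 𝕜 wS VS (R s) x‖ ≤ BR * Real.exp (-(κ * δ (πS x) v)) * F)
    (hDGR : ∀ (v : Y) (s : WL2 𝕜 wS VS) (F : ℝ), (∀ x, πS x ≠ v → WL2.equiv 𝕜 wS VS s x = 0) → (∀ x, ‖WL2.equiv 𝕜 wS VS s x‖ ≤ F) →
      ∀ x, ‖WL2.equiv 𝕜 wB VB (D (Gp (R s))) x‖ ≤ BD * Real.exp (-(κ * δ (πB x) v)) * F)
    (hM : ∀ (v : Y) (s : WL2 𝕜 wS VS) (F : ℝ), (∀ x, πS x ≠ v → WL2.equiv 𝕜 wS VS s x = 0) → (∀ x, ‖WL2.equiv 𝕜 wS VS s x‖ ≤ F) →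
      ∀ x, ‖WL2.equiv 𝕜 wB VB (M s) x‖ ≤ ε₁ * Real.exp (-(κ * δ (πB x) v)) * F)
    (hMt : ∀ (v : Y) (f : WL2 𝕜 wB VB) (F : ℝ), (∀ x, πB x ≠ v → WL2.equiv 𝕜 wB VB f x = 0) → (∀ x, ‖WL2.equiv 𝕜 wB VB f x‖ ≤ F) →
      ∀ x, ‖WL2.equiv 𝕜 wS VS (Mt f) x‖ ≤ ε₂ * Real.exp (-(κ * δ (πS x) v)) * F)
    (hS : ∀ w', ∑ u, Real.exp (-((κ - κ') * δ w' u)) ≤ K) (q₁ q₂ : ℝ)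
    (hq₁def : q₁ = BR * K * BG * K * ε₁ * K * B₀ * K + ε₂ * K * BG * K * BD * K + BD * K * ε₂ * K * BG * K * BD * K +
          ε₂ * K * BG * K * BR * K * BG * K * ε₁ * K * B₀ * K + BD * K * ε₂ * K * BG * K * BR * K * BG * K * ε₁ * K * B₀ * K)
    (hq₂def : q₂ = BR * K * BG * K * ε₁ * K * B₁ * K + ε₂ * K * BG * K * BR * K + BD * K * ε₂ * K * BG * K * BR * K +
          ε₂ * K * BG * K * BR * K * BG * K * ε₁ * K * B₁ * K + BD * K * ε₂ * K * BG * K * BR * K * BG * K * ε₁ * K * B₁ * K)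
    (hq₁ : q₁ < 1) (hq₂ : q₂ < 1) :
    (∀ (v : Y) (f : WL2 𝕜 wB VB) (F : ℝ), (∀ x, πB x ≠ v → WL2.equiv 𝕜 wB VB f x = 0) → (∀ x, ‖WL2.equiv 𝕜 wB VB f x‖ ≤ F) →
      ∀ x, ‖WL2.equiv 𝕜 wB VB (Gt f) x‖ ≤ max B₀ B₁ / (1 - max q₁ q₂) * Real.exp (-(κ' * δ (πB x) v)) * F) ∧
    (∀ (v : Y) (f : WL2 𝕜 wB VB) (F : ℝ), (∀ x, πB x ≠ v → WL2.equiv 𝕜 wB VB f x = 0) → (∀ x, ‖WL2.equiv 𝕜 wB VB f x‖ ≤ F) →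
      ∀ x, ‖WL2.equiv 𝕜 wS VS (Ds (Gt f)) x‖ ≤ max B₀ B₁ / (1 - max q₁ q₂) * Real.exp (-(κ' * δ (πS x) v)) * F) := by
  have hK : 0 ≤ K := by
    obtain ⟨x₀⟩ := ‹Nonempty XB›
    exact (Finset.sum_nonneg fun u _ => Real.exp_nonneg _).trans (hS (πB x₀))
  have hq₁0 : 0 ≤ q₁ := by rw [hq₁def]; positivity
  have hq₂0 : 0 ≤ q₂ := by rw [hq₂def]; positivity
  -- a-priori letters on the finite carriers, one common constant
  obtain ⟨M₁, hM₁, hA₁⟩ := exists_apriori_letter₂ (𝕜 := 𝕜) δ πB Gt hκ'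
  obtain ⟨M₂, hM₂, hA₂⟩ := exists_apriori_letter₂ (𝕜 := 𝕜) δ πS (Ds ∘L Gt) hκ'
  have hb : 0 ≤ max B₀ B₁ := hB₀.trans (le_max_left _ _)
  have hq0 : 0 ≤ max q₁ q₂ := hq₁0.trans (le_max_left _ _)
  have hq : max q₁ q₂ < 1 := max_lt hq₁ hq₂
  have hMM : 0 ≤ max M₁ M₂ := hM₁.trans (le_max_left _ _)
  refine letter_bootstrap_pair δ πB πB πS Gt (Ds ∘L Gt) hb hq0 hq hMM ?_ ?_ ?_
  · intro v f F _ hfF x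
    obtain ⟨x₀⟩ := ‹Nonempty XB›
    have hF : 0 ≤ F := (norm_nonneg _).trans (hfF x₀)
    exact (hA₁ v f F hfF x).trans (mul_le_mul_of_nonneg_right (mul_le_mul_of_nonneg_right (le_max_left _ _) (Real.exp_nonneg _)) hF)
  · intro v f F _ hfF x
    obtain ⟨x₀⟩ := ‹Nonempty XB›
    have hF : 0 ≤ F := (norm_nonneg _).trans (hfF x₀)
    exact (hA₂ v f F hfF x).trans (mul_le_mul_of_nonneg_right (mul_le_mul_of_nonneg_right (le_max_right _ _) (Real.exp_nonneg _)) hF)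
  · intro M' hM' h₁ h₂
    have step := transfer_pair_step δ πB πS G₀ Gt D M Ds Mt Gp R hδ0 hδt hT h2 h3 hB₀ hB₁ hBG hBR hBD hε₁ hε₂ hκ' hκ hM' hG0 hDsG0 hGp hR hDGR
      hM hMt hS h₁ h₂
    rw [← hq₁def, ← hq₂def] at step
    refine ⟨fun v f F hfv hfF x => ?_, fun v f F hfv hfF x => ?_⟩
    · obtain ⟨x₀⟩ := ‹Nonempty XB›
      have hF : 0 ≤ F := (norm_nonneg _).trans (hfF x₀)
      refine (step.1 v f F hfv hfF x).trans (mul_le_mul_of_nonneg_right (mul_le_mul_of_nonneg_right ?_ (Real.exp_nonneg _)) hF)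
      exact add_le_add (le_max_left _ _) (mul_le_mul_of_nonneg_right (le_max_left _ _) hM')
    · obtain ⟨x₀⟩ := ‹Nonempty XB›
      have hF : 0 ≤ F := (norm_nonneg _).trans (hfF x₀)
      refine (step.2 v f F hfv hfF x).trans (mul_le_mul_of_nonneg_right (mul_le_mul_of_nonneg_right ?_ (Real.exp_nonneg _)) hF)
      exact add_le_add (le_max_right _ _) (mul_le_mul_of_nonneg_right (le_max_right _ _) hM')

end Abstract


end Literature.MathematicalPhysics.QuantumFieldTheory.Balaban1983to89.B9Eq3130TransferPairLetters

end
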